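import Mathlib
import Literature.Analysis.FluidPDE.SuitableWeak
import Summits.NavierStokesRegularity.NavierStokesRegularity.Theses.TypeILiouville
import HarnessLib

/-!
# Shelf crux `EnstrophyQuarterLaw` (stmt-NavierStokesRegularity-1574), line «sparse_sieve»:
# on the Type-I shelf (stub 6) the S2 CORE is PARABOLIC — no `ε₀`-concentration at scales
# `r ≤ c₁ ε₀ √(T − t)` under sup-rate Type I

Helper file (`--supports stmt-NavierStokesRegularity-1574 --as helper`) for the OPEN registered stub
`stub_uniformSparseness` (S2), read together with stub 6 `stub_noTypeII` (= `TypeILiouville.TypeIliouvilleNoTypeII`,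
stmt-0056: every first blow-up is `IsTypeIBlowup`, i.e. `|u(t,x)| ≤ C/√(T−t)` eventually). Pure real analysis on
the Type-I bound — no Navier–Stokes structure is used:

* `no_concentration_below_parabolic_scale` — if `IsTypeIBlowup u T` then there are `c₁ > 0` and `t₁ < T` such that
  for every `ε₀ > 0`, `t ∈ (t₁, T)`, centre `x` and radius `0 < r ≤ c₁ ε₀ √(T−t)`: `∫_{B(x,2r)} |u(t)|³ < ε₀³`
  (the ball has volume `8|B₁|r³` and `|u| ≤ C/√(T−t)` on it);
* `card_eq_zero_below_parabolic_scale` — hence every S2-admissible family at such `(t, r)` is EMPTY;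
* `parabolicCore_of_stub_noTypeII` — under stub 6 this holds at EVERY first blow-up.

READING (census currency). Unconditionally the S2 core sits above the enstrophy scale `c₀ε₀²/Z(t)` (`EnstrophyScale`,
p817863); GIVEN stub 6 it sits above the parabolic scale `c₁ε₀√(T−t)`: on the Type-I shelf uniform sparseness is
a statement about PARABOLIC-OR-COARSER, near-field, late swarms only — the currency of TIQG's concentration count
(`k1_iff_s2_of_u`, census g36). HONEST FRAMING: S2, stub 6 (0056), the crux `EnstrophyQuarterLaw` (1574) and
Navier–Stokes regularity stay OPEN; no summit statement is proved.
-/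

noncomputable section

-- the summit and its single sub-problem share the name (CONVENTIONS §1), as in every Theorems file
set_option linter.dupNamespace false

namespace Summit.NavierStokesRegularity.NavierStokesRegularity.Theorems.EnstrophyQuarterLaw.TypeICore

open MeasureTheory Set Metric Filter Topology Module
open Literature.Analysis Literature.Analysis.FluidPDE
open scoped ENNReal NNReal

/-- **No `L³`-concentration below the parabolic scale under sup-rate Type I.** If `|u(t,x)| ≤ C/√(T−t)`
eventually as `t ↑ T` (`IsTypeIBlowup u T`), then there are `c₁ > 0` and `t₁ < T` with: for every `ε₀ > 0`,
`t ∈ (t₁,T)`, `x` and `0 < r ≤ c₁ ε₀ √(T−t)`, `∫_{B(x,2r)} |u(t)|³ < ε₀³`. (`c₁ = 1/((8|B₁|+1)·max C 1)`.)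
[folklore] -/
theorem no_concentration_below_parabolic_scale {T : ℝ}
    {u : ℝ → EuclideanSpace ℝ (Fin 3) → EuclideanSpace ℝ (Fin 3)} (hI : IsTypeIBlowup u T) :
    ∃ c₁ t₁ : ℝ, 0 < c₁ ∧ t₁ < T ∧ ∀ ε₀ : ℝ, 0 < ε₀ → ∀ t ∈ Ioo t₁ T,
      ∀ (x : EuclideanSpace ℝ (Fin 3)) (r : ℝ), 0 < r → r ≤ c₁ * ε₀ * Real.sqrt (T - t) →
        ∫⁻ y in ball x (2 * r), ‖u t y‖ₑ ^ 3 < ENNReal.ofReal (ε₀ ^ 3) := by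
  obtain ⟨C, hC⟩ := hI
  obtain ⟨t₁, ht₁T, hsub⟩ := mem_nhdsLT_iff_exists_Ioo_subset.1 hC
  -- constants
  set V₁ : ℝ≥0∞ := volume (ball (0 : EuclideanSpace ℝ (Fin 3)) 1) with hV₁
  have hV₁top : V₁ ≠ ⊤ := measure_ball_lt_top.ne
  set V : ℝ := 8 * V₁.toReal with hV
  have hV0 : 0 ≤ V := by positivity
  set C' : ℝ := max C 1 with hC'
  have hC'pos : 0 < C' := lt_of_lt_of_le one_pos (le_max_right _ _)
  refine ⟨1 / ((V + 1) * C'), t₁, by positivity, ht₁T, fun ε₀ hε₀ t ht x r hr hrle => ?_⟩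
  have hTt : 0 < T - t := by linarith [ht.2]
  have hsq : 0 < Real.sqrt (T - t) := Real.sqrt_pos.2 hTt
  -- the pointwise bound on the slice
  have hpt : ∀ y, ‖u t y‖ₑ ^ 3 ≤ ENNReal.ofReal ((C' / Real.sqrt (T - t)) ^ 3) := by
    intro y
    have h1 : ‖u t y‖ ≤ C' / Real.sqrt (T - t) :=
      (hsub ht y).trans (div_le_div_of_nonneg_right (le_max_left _ _) hsq.le)
    rw [← ofReal_norm, ← ENNReal.ofReal_pow (norm_nonneg _)]
    exact ENNReal.ofReal_le_ofReal (pow_le_pow_left₀ (norm_nonneg _) h1 3)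
  -- integrate over the ball
  have hvol : volume (ball x (2 * r)) = ENNReal.ofReal (8 * r ^ 3) * V₁ := by
    rw [Measure.addHaar_ball_of_pos _ _ (by positivity : (0 : ℝ) < 2 * r), finrank_euclideanSpace_fin,
      show (2 * r) ^ 3 = 8 * r ^ 3 by ring]
  have hle : ∫⁻ y in ball x (2 * r), ‖u t y‖ₑ ^ 3 ≤
      ENNReal.ofReal (V * (C' * r / Real.sqrt (T - t)) ^ 3) := by
    calc ∫⁻ y in ball x (2 * r), ‖u t y‖ₑ ^ 3
        ≤ ∫⁻ _ in ball x (2 * r), ENNReal.ofReal ((C' / Real.sqrt (T - t)) ^ 3) :=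
          setLIntegral_mono measurable_const fun y _ => hpt y
      _ = ENNReal.ofReal ((C' / Real.sqrt (T - t)) ^ 3) * (ENNReal.ofReal (8 * r ^ 3) * V₁) := by
          rw [setLIntegral_const, hvol]
      _ = ENNReal.ofReal (V * (C' * r / Real.sqrt (T - t)) ^ 3) := by
          rw [← ENNReal.ofReal_toReal hV₁top, ← ENNReal.ofReal_mul (by positivity),
            ← ENNReal.ofReal_mul (by positivity), hV]
          congr 1
          field_simp
  refine lt_of_le_of_lt hle ((ENNReal.ofReal_lt_ofReal_iff (by positivity)).2 ?_)
  -- real arithmetic: `C' r / √(T−t) ≤ ε₀/(V+1)` and `V/(V+1)³ < 1`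
  have hq : C' * r / Real.sqrt (T - t) ≤ ε₀ / (V + 1) := by
    rw [div_le_iff₀ hsq]
    have : r * ((V + 1) * C') ≤ ε₀ * Real.sqrt (T - t) := by
      have h := mul_le_mul_of_nonneg_right hrle (by positivity : 0 ≤ (V + 1) * C')
      calc r * ((V + 1) * C') ≤ 1 / ((V + 1) * C') * ε₀ * Real.sqrt (T - t) * ((V + 1) * C') := h
        _ = ε₀ * Real.sqrt (T - t) := by field_simp
    calc C' * r = r * ((V + 1) * C') / (V + 1) := by field_simp
      _ ≤ ε₀ * Real.sqrt (T - t) / (V + 1) := div_le_div_of_nonneg_right this (by positivity)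
      _ = ε₀ / (V + 1) * Real.sqrt (T - t) := by ring
  have hq0 : 0 ≤ C' * r / Real.sqrt (T - t) := by positivity
  calc V * (C' * r / Real.sqrt (T - t)) ^ 3 ≤ V * (ε₀ / (V + 1)) ^ 3 :=
        mul_le_mul_of_nonneg_left (pow_le_pow_left₀ hq0 hq 3) hV0
    _ = ε₀ ^ 3 * (V / (V + 1) ^ 3) := by field_simp
    _ < ε₀ ^ 3 * 1 := by
        refine mul_lt_mul_of_pos_left ?_ (by positivity)
        rw [div_lt_one (by positivity)]
        have h1 : V + 1 ≤ (V + 1) ^ 3 := le_self_pow₀ (by linarith) (by norm_num)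
        linarith
    _ = ε₀ ^ 3 := mul_one _

/-- **Corollary in the S2 currency:** under `IsTypeIBlowup u T`, with `c₁, t₁` as above, every finite family of
centres whose balls `B(x,2r)` `ε₀`-concentrate at a time `t ∈ (t₁,T)` and a scale `0 < r ≤ c₁ε₀√(T−t)` is
EMPTY. [folklore] -/
theorem card_eq_zero_below_parabolic_scale {T : ℝ}
    {u : ℝ → EuclideanSpace ℝ (Fin 3) → EuclideanSpace ℝ (Fin 3)} (hI : IsTypeIBlowup u T) :
    ∃ c₁ t₁ : ℝ, 0 < c₁ ∧ t₁ < T ∧ ∀ ε₀ : ℝ, 0 < ε₀ → ∀ t ∈ Ioo t₁ T, ∀ r : ℝ, 0 < r →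
      r ≤ c₁ * ε₀ * Real.sqrt (T - t) →
      ∀ F : Finset (EuclideanSpace ℝ (Fin 3)),
        (∀ x ∈ F, ENNReal.ofReal (ε₀ ^ 3) ≤ ∫⁻ y in ball x (2 * r), ‖u t y‖ₑ ^ 3) → F.card = 0 := by
  obtain ⟨c₁, t₁, hc₁, ht₁, h⟩ := no_concentration_below_parabolic_scale hI
  refine ⟨c₁, t₁, hc₁, ht₁, fun ε₀ hε₀ t ht r hr hrle F hF => ?_⟩
  rw [Finset.card_eq_zero, Finset.eq_empty_iff_forall_notMem]
  intro x hx
  exact absurd (hF x hx) (not_le.2 (h ε₀ hε₀ t ht x r hr hrle))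

/-- **Under stub 6 the S2 core is parabolic at every first blow-up.** `TypeIliouvilleNoTypeII` (stmt-0056, the
registered stub `stub_noTypeII`) gives `IsTypeIBlowup u T` for every maximal classical solution on `[0,T)` that is
Leray–Hopf from a rapidly decaying datum, hence the conclusion of `no_concentration_below_parabolic_scale` for it.
Conditional on an OPEN statement; no summit statement is proved. [folklore] -/
theorem parabolicCore_of_stub_noTypeII
    (hS6 : Summit.NavierStokesRegularity.NavierStokesRegularity.Theses.TypeILiouville.TypeIliouvilleNoTypeII) :
    ∀ (ν T : ℝ), 0 < ν → 0 < T →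
      ∀ (u : ℝ → EuclideanSpace ℝ (Fin 3) → EuclideanSpace ℝ (Fin 3))
        (p : ℝ → EuclideanSpace ℝ (Fin 3) → ℝ),
      IsMaximalSmoothSolution ν 0 u p T → IsLerayHopfOn T ν 0 (u 0) u →
      HasRapidSpatialDecay (u 0) →
      ∃ c₁ t₁ : ℝ, 0 < c₁ ∧ t₁ < T ∧ ∀ ε₀ : ℝ, 0 < ε₀ → ∀ t ∈ Ioo t₁ T,
        ∀ (x : EuclideanSpace ℝ (Fin 3)) (r : ℝ), 0 < r → r ≤ c₁ * ε₀ * Real.sqrt (T - t) →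
          ∫⁻ y in ball x (2 * r), ‖u t y‖ₑ ^ 3 < ENNReal.ofReal (ε₀ ^ 3) :=
  fun ν T hν hT u p hmax hLH hdec =>
    no_concentration_below_parabolic_scale (hS6 ν T hν hT u p hmax hLH hdec)

end Summit.NavierStokesRegularity.NavierStokesRegularity.Theorems.EnstrophyQuarterLaw.TypeICore

end
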